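import Summits.QuantumFields.YangMills.Theorems.UnitScaleTiltProp7PA2HoldsT3
import Summits.QuantumFields.YangMills.Theorems.UnitScaleTiltProp7HN06Holds
import HarnessLib

/-!
# Route `UnitScaleTilt`, crux K1 «MinimiserStabilityRegPr» (stmt-QuantumFields-19200), E′ growth side — **THE GROWTH ROW (141)–(142) `hcoS` IS A TREE THEOREM**
# (architecture (A′) «`hcoS` ⟸ (N06)ᶜ ∧ (β)»: (β) CLOSED ✓p724900 `hD_holds`; (N06)ᶜ CLOSED ✓`Prop7HN06Holds.hN06_holds` (★p1 g20's lane II over px9's PATCHES1 `patch_rows`))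

Cell `ym3-torus`, twin-width seat `ym-routeR-w1` (gen 11; ★★OWNER WORD 25 (B), ★p1 g20 first refusal).  THEOREMS ONLY (0 `def`, 0 `sorry`, 0 `instance`); default heartbeats;
`--supports stmt-QuantumFields-19200 --as helper`, count-neutral.  YM₃ on T³ is a ladder rung (R3), NOT the Clay problem; nothing here claims the stub `stub_existenceMinimalOrbit`,
the crux, the N06 PRINT rows, d = 4 or the mass gap.

WHAT.  `hcoS_holds (c₀ cB a₀) (ha₀ : ∀ L, 0 < a₀ L)` : [Balaban1985Variational] (141)–(142) — `wilsonAction4 W ≤ wilsonAction4 (emb15 W (expHermField X))` for every printed-regular `W`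
on the fibre of `V` and every Σ-representative `X` in the (19)-window with the averaging and projected-Landau conditions (conclusion of ✓`Prop7HcoSOfNormG0DiffRow.hcoS_of_normG0_of_diffL1`
VERBATIM) — with NO displayed hypothesis: the weights `c₀ cB > 0` and the comb-penalty weight `a₀ > 0` are the only letters.  PROOF = ✓p724900 `Prop7PA2Holds.hcoS_of_hN06` ∘
✓`Prop7HN06Holds.hN06_holds` (one term; `ha₀` fed in both spellings).
WHAT THIS IS NOT.  Not an EX S-event (the EX display composes `hN06` inside); not a proof of the N06 print rows, of `hThm2S`, of EX, of the crux or of any summit statement;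
not d = 4, not infinite volume, not a mass gap, not Clay.
References: T. Bałaban, CMP 102 (1985) 277–309 [Balaban1985Variational] ((141)–(142) p.299); CMP 99 (1985) 389–434 [Balaban1985BackgroundPropagators] (Thm 3.11 p.416, (3.26) p.395).
-/

set_option autoImplicit false

noncomputable section

open scoped BigOperators Matrix.Norms.L2Operator Matrix Topology InnerProductSpace
open Filter NormedSpace

namespace Summit.QuantumFields.YangMills.Theorems.Prop7HcoSClosed

open Literature.MathematicalPhysics.QuantumFieldTheory.Balaban1983to89
open Literature.MathematicalPhysics.QuantumFieldTheory.Balaban1983to89.T3ContinuumYM3Torus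
open Literature.MathematicalPhysics.QuantumFieldTheory.Balaban1983to89.T3UnitLawDensityEML (ℰp)
open Literature.MathematicalPhysics.QuantumFieldTheory.Balaban1983to89.T3ConstrainedMinimiser (fibre)
open Literature.MathematicalPhysics.QuantumFieldTheory.Balaban1983to89.T3PrintedRegularMinimiser
open Literature.MathematicalPhysics.QuantumFieldTheory.Balaban1983to89.T3RegularMinimiser
open Literature.MathematicalPhysics.QuantumFieldTheory.Balaban1983to89.T3Thm1Carrier
open T4Continuum BlockAveraging AveragingRT ExpMeanLog BlockAveragingEMLLinearised BlockAveragingEMLLinearisedBackground BlockAveragingEMLProp2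
open B7Prop1Explicit (expUnit)
open B10Eq27TorusAxialLog (pull unitsField toUField)
open B9Eq39Adjoint (divB)
open B9TorusCalculus (torusT)
open T3SectALandauChart (emb15 eta eta_pos bgUnits In19)
open B11Eq103H1Complex (SiteL2K BondL2K laplaceAK)
open Summit.QuantumFields.YangMills.Theorems.Prop7SPrint (basePt RestrictedPrint AvgCondPrint IsLandauPrint)
open Summit.QuantumFields.YangMills.Theorems.Prop7TPrint (expHermField)
open Summit.QuantumFields.YangMills.Theorems.Prop7SectET3Transport (periodsT3)
open Summit.QuantumFields.YangMills.Theorems.Prop7SectET3HilbertLetters (W₂ toL2 toL2B DL2 DstarL2 covLapSite)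
open Summit.QuantumFields.YangMills.Theorems.Prop7SymAvgTw (frameTw QTw CmapTw)
open Summit.QuantumFields.YangMills.Theorems.Prop7SymAvgTwSym (frameTwS CmapTwS)
open Summit.QuantumFields.YangMills.Theorems.Prop7PA2Holds (hcoS_of_hN06)
open Summit.QuantumFields.YangMills.Theorems.Prop7HN06Holds (hN06_holds)

/-- ★★★ **THE GROWTH ROW (141)–(142) `hcoS` AT THE LANE-II LETTERS `c₀ cB a₀`** — conclusion = ✓`Prop7HcoSOfNormG0DiffRow.hcoS_of_normG0_of_diffL1`'s VERBATIM (the E′ socket); hypotheses: none beyond the letters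
`c₀ cB a₀` with `0 < a₀ L`.  PROOF = `hcoS_of_hN06 ∘ hN06_holds`.  [cite: Balaban1985Variational, (141)-(142) p.299; Balaban1985BackgroundPropagators, Thm 3.11 p.416] -/
theorem hcoS_holds_at (c₀ cB a₀ : ℕ → ℝ) [hc₀ : ∀ L : ℕ, Fact (0 < c₀ L)] [hcB : ∀ L : ℕ, Fact (0 < cB L)] (ha₀ : ∀ L : ℕ, 0 < a₀ L) :
    ∀ (L : ℕ), 1 < L → ∀ (B₁' : ℝ), 0 < B₁' → ∃ e₇ : ℝ, 0 < e₇ ∧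
      ∀ (F : T3Family), F.L = L → ∀ (n K : ℕ) (hnK : n < K) (e : ℝ) (V : GaugeField (F.P n) 0 (Matrix.specialUnitaryGroup (Fin 2) ℂ))
        (W : GaugeField (F.P K) 0 (Matrix.specialUnitaryGroup (Fin 2) ℂ)) (X : PBond (F.P K) 0 → Matrix (Fin 2) (Fin 2) ℂ),
        0 < e → e ≤ e₇ → W ∈ regFibrePr F n K hnK.le e V →
        (∀ γ : ℝ → GaugeField (F.P K) 0 (Matrix.specialUnitaryGroup (Fin 2) ℂ), γ 0 = W → (∀ t, γ t ∈ fibre F ℰp n K hnK.le V) →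
          (∀ b, DifferentiableAt ℝ (fun t => ((γ t b : Matrix.specialUnitaryGroup (Fin 2) ℂ) : Matrix (Fin 2) (Fin 2) ℂ)) 0) →
            deriv (fun t => wilsonAction4 (γ t)) 0 = 0) →
        In19 F n K (2 * B₁' * e) W (expHermField X) X → AvgCondPrint F n K hnK.le V W X → IsLandauPrint F n K W X →
          wilsonAction4 W ≤ wilsonAction4 (emb15 W (expHermField X)) :=
  hcoS_of_hN06 c₀ cB a₀ (fun L => (ha₀ L).le) (hN06_holds c₀ cB a₀ (fun L _ => ha₀ L))

/-- ★★★★ **THE GROWTH ROW (141)–(142) `hcoS` — NO LETTERS**: the weights `c₀ cB` and the comb-penalty weight `a₀` of the lane-II door do not occur in the (141)–(142) statement, so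
`hcoS_holds_at` at `c₀ = cB = a₀ ≡ 1` is the growth row OUTRIGHT.  [cite: Balaban1985Variational, (141)-(142) p.299] -/
theorem hcoS_holds :
    ∀ (L : ℕ), 1 < L → ∀ (B₁' : ℝ), 0 < B₁' → ∃ e₇ : ℝ, 0 < e₇ ∧
      ∀ (F : T3Family), F.L = L → ∀ (n K : ℕ) (hnK : n < K) (e : ℝ) (V : GaugeField (F.P n) 0 (Matrix.specialUnitaryGroup (Fin 2) ℂ))
        (W : GaugeField (F.P K) 0 (Matrix.specialUnitaryGroup (Fin 2) ℂ)) (X : PBond (F.P K) 0 → Matrix (Fin 2) (Fin 2) ℂ),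
        0 < e → e ≤ e₇ → W ∈ regFibrePr F n K hnK.le e V →
        (∀ γ : ℝ → GaugeField (F.P K) 0 (Matrix.specialUnitaryGroup (Fin 2) ℂ), γ 0 = W → (∀ t, γ t ∈ fibre F ℰp n K hnK.le V) →
          (∀ b, DifferentiableAt ℝ (fun t => ((γ t b : Matrix.specialUnitaryGroup (Fin 2) ℂ) : Matrix (Fin 2) (Fin 2) ℂ)) 0) →
            deriv (fun t => wilsonAction4 (γ t)) 0 = 0) →
        In19 F n K (2 * B₁' * e) W (expHermField X) X → AvgCondPrint F n K hnK.le V W X → IsLandauPrint F n K W X →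
          wilsonAction4 W ≤ wilsonAction4 (emb15 W (expHermField X)) :=
  @hcoS_holds_at (fun _ => 1) (fun _ => 1) (fun _ => 1) (fun _ => ⟨one_pos⟩) (fun _ => ⟨one_pos⟩) (fun _ => one_pos)

end Summit.QuantumFields.YangMills.Theorems.Prop7HcoSClosed

end
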